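import Literature.Computability.QuantumComplexity.PhaseQueryOps
import Literature.Computability.Cryptography.OracleKickback
import HarnessLib

/-!
# Classical reversible programs with oracle queries act classically on basis states

Topic `Literature/Computability/QuantumComplexity`; first file of the discharge of the named fact
`uniformOracleCoinSimulation` (`CoinFamilyKernel.lean`: the polynomial-time uniform reversible
simulation, *with oracle gates*, of a polynomial-time oracle algorithm run on `⟨x, coins⟩` — the
relativised classical core of Bernstein–Vazirani 1997, Thm. 8.3, carried out with oracle queries as
in their §8.3: "If the target bit `|b⟩` was supplied in initial state `|0⟩`, then its final state
will be `|f(x)⟩`, just as in a classical oracle machine").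

The simulating circuits are compiled from `ℕ`-wired programs in the operation type `RtOp` of
`RazTalBlocks.lean` (classical `NOT`/`CNOT`/Toffoli operations `RtOp.cl` and oracle queries
`RtOp.oracle qs t` on the query wires `qs` with answer wire `t`; compilation `RtOp.compileList`,
descriptions `RazTalMachineUniform.lean`). This file provides their **classical semantics relative to
an oracle language `A`** and the bridge to the circuit semantics:

* `OSim.ocAct A op`, `OSim.ocEval A ops` — the action on assignments `ι → Bool`: a classical
  operation acts by `ClOp.eval`, a query `oracle qs t` XORs `[qs-contents ∈ A]` into `t`
  (Hadamard operations, not used here, act trivially); `ocEval_append`, `ocEval_map_cl`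
  (`= clEval`), frame and agreement lemmas, transport along injective re-indexings
  (`ocEval_map_comp`) and along `finOf` (`liftW_ocEval_map`);
* **`OSim.compileList_mulVec_basisState`** — a compiled program of classical operations and
  queries maps the basis state `|w⟩` to the basis state `|ocEval A ops w⟩` (classical gates:
  `RevOp.compile_mulVec_basisState`; queries: `placeGate_oracleGate_mulVec_basisState` of
  `OracleKickback.lean`);
* for the garbage-free block `RevClean.cleanOps e M n₀ []` of `RevUncompute.lean` (empty suffix;
  applied twice it is the identity on every assignment, `RevClean.clEval_cleanOps_cleanOps` of
  `PhaseQueryOps.lean`, which is how the simulation clears its stage register after each oracle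
  round): `OSim.clEval_cleanOps_shift` — the semantics of the block placed at an offset inside a
  larger register whose other wires are arbitrary (transport of `RevClean.clEval_cleanOps`).

## References

* E. Bernstein, U. Vazirani, *Quantum complexity theory*, SIAM J. Comput. 26 (1997) 1411–1473,
  Thm. 8.3 (p. 1451) and §8.3 (p. 1455, oracle QTMs) [BernsteinVazirani1997SICOMP].
* C. H. Bennett, E. Bernstein, G. Brassard, U. Vazirani, *Strengths and weaknesses of quantum
  computing*, SIAM J. Comput. 26 (1997) 1510–1523, §2 (arXiv:quant-ph/9701001, p. 4: oracle calls
  on basis states behave classically) [BennettBernsteinBrassardVazirani1997].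
* M. A. Nielsen, I. L. Chuang, *Quantum Computation and Quantum Information*, CUP 2010, §3.2.5
  (uncomputation), §6.1.1 (the XOR oracle) [NielsenChuang2010].
-/

noncomputable section

namespace Literature.Computability.QuantumComplexity

namespace OSim

open Cryptography RazTalMachine RevSim RevClean Matrix

/-! ### Classical semantics of programs with queries -/

section Semantics

variable {ι κ : Type} [DecidableEq ι] (A : Language Bool)

/-- The classical action of an operation relative to the oracle language `A`: classical gates act by
`ClOp.eval`, a query `oracle qs t` XORs the answer bit `[w(qs) ∈ A]` into the answer wire `t`;
Hadamard operations (not classical) are sent to the identity. [cite: BernsteinVazirani1997SICOMP, §8.3 (p. 1455: "its final state will be |f(x)⟩, just as in a classical oracle machine")] -/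
def ocAct : RtOp ι → (ι → Bool) → (ι → Bool)
  | .cl op, w => op.eval w
  | .had _, w => w
  | .chad _ _, w => w
  | .oracle qs t, w => Function.update w t (w t ^^ A.boolIndicator (qs.map w))

/-- The classical action of a program (head first). [cite: BernsteinVazirani1997SICOMP, §8.3] -/
def ocEval : List (RtOp ι) → (ι → Bool) → (ι → Bool)
  | [], w => w
  | op :: ops, w => ocEval ops (ocAct A op w)

/-- An operation is classical-or-query (no Hadamard). [folklore] -/
def IsCl : RtOp ι → Prop
  | .cl _ => True
  | .had _ => False
  | .chad _ _ => False
  | .oracle _ _ => True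

omit [DecidableEq ι] in
/-- Classical operations are classical-or-query. [folklore] -/
@[simp] theorem isCl_cl (op : ClOp ι) : IsCl (RtOp.cl op : RtOp ι) := trivial

omit [DecidableEq ι] in
/-- Queries are classical-or-query. [folklore] -/
@[simp] theorem isCl_oracle (qs : List ι) (t : ι) : IsCl (RtOp.oracle qs t : RtOp ι) := trivial

omit [DecidableEq ι] in
/-- `IsCl` is preserved by re-indexing. [folklore] -/
theorem IsCl.map {op : RtOp ι} (h : IsCl op) (f : ι → κ) : IsCl (op.map f) := by
  cases op <;> trivial

/-- `ocEval` of the empty program. [folklore] -/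
@[simp] theorem ocEval_nil (w : ι → Bool) : ocEval A ([] : List (RtOp ι)) w = w := rfl

/-- `ocEval` of a `cons`. [folklore] -/
@[simp] theorem ocEval_cons (op : RtOp ι) (ops : List (RtOp ι)) (w : ι → Bool) :
    ocEval A (op :: ops) w = ocEval A ops (ocAct A op w) := rfl

/-- `ocEval` of a concatenation. [folklore] -/
theorem ocEval_append (ops ops' : List (RtOp ι)) (w : ι → Bool) :
    ocEval A (ops ++ ops') w = ocEval A ops' (ocEval A ops w) := by
  induction ops generalizing w with
  | nil => rfl
  | cons op ops ih => exact ih _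

/-- On classical operations `ocEval` is `clEval`. [folklore] -/
theorem ocEval_map_cl (ops : List (ClOp ι)) (w : ι → Bool) :
    ocEval A (ops.map RtOp.cl) w = clEval ops w := by
  induction ops generalizing w with
  | nil => rfl
  | cons op ops ih => rw [List.map_cons, ocEval_cons, clEval_cons]; exact ih _

/-- A single query. [folklore] -/
theorem ocEval_oracle (qs : List ι) (t : ι) (w : ι → Bool) :
    ocEval A [RtOp.oracle qs t] w = Function.update w t (w t ^^ A.boolIndicator (qs.map w)) := rfl

/-- The written wire of an operation (`none` for Hadamards, which write nothing classically).
[folklore] -/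
def tgt : RtOp ι → Option ι
  | .cl op => some op.target
  | .had _ => none
  | .chad _ _ => none
  | .oracle _ t => some t

/-- An operation changes at most its written wire. [folklore] -/
theorem ocAct_apply_of_ne (op : RtOp ι) (w : ι → Bool) {i : ι} (h : tgt op ≠ some i) :
    ocAct A op w i = w i := by
  cases op with
  | cl op => exact ClOp.eval_apply_of_ne op w fun e => h (by rw [e]; rfl)
  | had a => rfl
  | chad c a => rfl
  | oracle qs t =>
    have hne : i ≠ t := fun e => h (by rw [e]; rfl)
    simp [ocAct, Function.update_of_ne hne]

omit [DecidableEq ι] in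
/-- The written wire is a wire of the operation. [folklore] -/
theorem mem_wires_of_tgt {op : RtOp ι} {i : ι} (h : tgt op = some i) : i ∈ op.wires := by
  cases op with
  | cl op => cases h; simp [RtOp.wires, wiresOf]
  | had a => cases h
  | chad c a => cases h
  | oracle qs t => cases h; simp [RtOp.wires]

/-- **Frame rule**: a wire written by no operation of the program is unchanged. [folklore] -/
theorem ocEval_apply_of_forall_ne (ops : List (RtOp ι)) (w : ι → Bool) {i : ι}
    (h : ∀ op ∈ ops, tgt op ≠ some i) : ocEval A ops w i = w i := by
  induction ops generalizing w with
  | nil => rfl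
  | cons op ops ih =>
    rw [ocEval_cons, ih _ fun o ho => h o (List.mem_cons_of_mem _ ho),
      ocAct_apply_of_ne A op w (h op (by simp))]

/-- A wire outside all the wires of the program is unchanged. [folklore] -/
theorem ocEval_apply_of_forall_not_mem (ops : List (RtOp ι)) (w : ι → Bool) {i : ι}
    (h : ∀ op ∈ ops, i ∉ op.wires) : ocEval A ops w i = w i :=
  ocEval_apply_of_forall_ne A ops w fun op hop e => h op hop (mem_wires_of_tgt e)

/-- The action of an operation on a wire depends only on the wires of the operation. [folklore] -/
theorem ocAct_congr (op : RtOp ι) {w w' : ι → Bool} (h : ∀ i ∈ op.wires, w i = w' i)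
    {i : ι} (hi : i ∈ op.wires) : ocAct A op w i = ocAct A op w' i := by
  cases op with
  | cl op =>
    simp only [ocAct, ClOp.eval_apply]
    rw [h i hi, ClOp.guard_congr op fun c hc => h c (by simp [RtOp.wires, wiresOf, hc])]
  | had a => exact h i hi
  | chad c a => exact h i hi
  | oracle qs t =>
    have ht : t ∈ (RtOp.oracle qs t : RtOp ι).wires := by simp [RtOp.wires]
    have hq : qs.map w = qs.map w' := List.map_congr_left fun j hj => h j (by simp [RtOp.wires, hj])
    simp only [ocAct]
    by_cases hit : i = t
    · subst hit; simp [h i ht, hq]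
    · simp [Function.update_of_ne hit, h i hi]

/-- **Agreement**: two assignments agreeing on a set of wires containing all wires of the program
still agree there after the program. [folklore] -/
theorem ocEval_agree (P : ι → Prop) :
    ∀ (ops : List (RtOp ι)) (_ : ∀ op ∈ ops, ∀ i ∈ op.wires, P i) {w w' : ι → Bool}
      (_ : ∀ i, P i → w i = w' i) (i : ι), P i → ocEval A ops w i = ocEval A ops w' i
  | [], _, _, _, hw, i, hi => hw i hi
  | op :: ops, hops, w, w', hw, i, hi => by
    rw [ocEval_cons, ocEval_cons]
    refine ocEval_agree P ops (fun o ho => hops o (List.mem_cons_of_mem _ ho)) (fun i' hi' => ?_) i hi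
    by_cases hmem : i' ∈ op.wires
    · exact ocAct_congr A op (fun j hj => hw j (hops op (by simp) j hj)) hmem
    · rw [ocAct_apply_of_ne A op w (fun e => hmem (mem_wires_of_tgt e)),
        ocAct_apply_of_ne A op w' (fun e => hmem (mem_wires_of_tgt e)), hw i' hi']

/-- **Locality**: the program restricted to a set of wires containing all its wires — outside the
set nothing changes, inside the result depends only on the inside. [folklore] -/
theorem ocEval_ite (P : ι → Prop) [DecidablePred P] (ops : List (RtOp ι))
    (hops : ∀ op ∈ ops, ∀ i ∈ op.wires, P i) (g w : ι → Bool) :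
    ocEval A ops (fun i => if P i then w i else g i) = fun i => if P i then ocEval A ops w i else g i := by
  funext i
  by_cases hi : P i
  · rw [if_pos hi]
    exact ocEval_agree A P ops hops (fun j hj => by rw [if_pos hj]) i hi
  · rw [if_neg hi, ocEval_apply_of_forall_not_mem A ops _ fun op hop hmem => hi (hops op hop i hmem), if_neg hi]

/-! ### Transport along re-indexings -/

omit [DecidableEq ι] in
/-- The wires of a re-indexed operation (restated from `RazTalBlocks.lean`). [folklore] -/
theorem wires_map (f : ι → κ) (op : RtOp ι) : (op.map f).wires = op.wires.map f := RtOp.wires_map f op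

/-- One re-indexed operation, along an injective map, on the image wires. [folklore] -/
theorem ocAct_map_comp [DecidableEq κ] {f : ι → κ} (hf : Function.Injective f) (op : RtOp ι) (w : κ → Bool) :
    ocAct A (op.map f) w ∘ f = ocAct A op (w ∘ f) := by
  cases op with
  | cl op => exact ClOp.eval_map_comp hf op w
  | had a => rfl
  | chad c a => rfl
  | oracle qs t =>
    funext i
    simp only [RtOp.map, ocAct, Function.comp_apply, List.map_map]
    by_cases hit : i = t
    · subst hit; simp [Function.comp_def]
    · rw [Function.update_of_ne (fun e => hit (hf e)), Function.update_of_ne hit]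
      rfl

omit [DecidableEq ι] in
/-- A re-indexed operation does not touch wires outside the image. [folklore] -/
theorem ocAct_map_apply_of_not_mem_range [DecidableEq κ] (f : ι → κ) (op : RtOp ι) (w : κ → Bool) {j : κ}
    (hj : j ∉ Set.range f) : ocAct A (op.map f) w j = w j := by
  refine ocAct_apply_of_ne A _ w fun e => hj ?_
  cases op with
  | cl op => exact ⟨op.target, by simpa [tgt, RtOp.map] using e⟩
  | had a => cases e
  | chad c a => cases e
  | oracle qs t => exact ⟨t, by simpa [tgt, RtOp.map] using e⟩

/-- **Transport along an injective re-indexing**: on the image wires the re-indexed program computes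
the original program on the pulled-back assignment. [folklore] -/
theorem ocEval_map_comp [DecidableEq κ] {f : ι → κ} (hf : Function.Injective f) (ops : List (RtOp ι)) (w : κ → Bool) :
    ocEval A (ops.map (RtOp.map f)) w ∘ f = ocEval A ops (w ∘ f) := by
  induction ops generalizing w with
  | nil => rfl
  | cons op ops ih => rw [List.map_cons, ocEval_cons, ocEval_cons, ih, ocAct_map_comp A hf]

omit [DecidableEq ι] in
/-- A re-indexed program does not touch wires outside the image. [folklore] -/
theorem ocEval_map_apply_of_not_mem_range [DecidableEq κ] (f : ι → κ) (ops : List (RtOp ι)) (w : κ → Bool) {j : κ}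
    (hj : j ∉ Set.range f) : ocEval A (ops.map (RtOp.map f)) w j = w j := by
  induction ops generalizing w with
  | nil => rfl
  | cons op ops ih => rw [List.map_cons, ocEval_cons, ih, ocAct_map_apply_of_not_mem_range A f op w hj]

end Semantics

/-! ### From `ℕ`-wired programs to `Fin N` -/

section Transport

variable (A : Language Bool) {N : ℕ} (hN : 0 < N)

/-- Reading the query wires through `finOf` below `N`. [folklore] -/
theorem map_comp_finOf_eq {qs : List ℕ} (hqs : ∀ i ∈ qs, i < N) (w : Fin N → Bool) :
    qs.map (w ∘ finOf N hN) = qs.map (liftW w) :=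
  List.map_congr_left fun i hi => liftW_comp_finOf hN w (hqs i hi)

/-- One re-indexed operation acts as the original on the extension by zeros. [folklore] -/
theorem liftW_ocAct_map (op : RtOp ℕ) (hop : ∀ i ∈ op.wires, i < N) (w : Fin N → Bool) :
    liftW (ocAct A (op.map (finOf N hN)) w) = ocAct A op (liftW w) := by
  cases op with
  | cl op => exact liftW_eval_map hN op (fun i hi => hop i hi) w
  | had a => rfl
  | chad c a => rfl
  | oracle qs t =>
    have ht : t < N := hop t (by simp [RtOp.wires])
    have hq : (qs.map (finOf N hN)).map w = qs.map (liftW w) := by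
      rw [List.map_map]; exact map_comp_finOf_eq hN (fun i hi => hop i (by simp [RtOp.wires, hi])) w
    funext i
    simp only [RtOp.map, ocAct, hq]
    by_cases hi : i < N
    · have e1 : liftW (Function.update w (finOf N hN t) (w (finOf N hN t) ^^ A.boolIndicator (qs.map (liftW w)))) i =
          Function.update w (finOf N hN t) (w (finOf N hN t) ^^ A.boolIndicator (qs.map (liftW w))) ⟨i, hi⟩ := by
        simp [liftW, hi]
      rw [e1, finOf_of_lt hN ht]
      by_cases hit : i = t
      · subst hit
        simp [liftW, hi]
      · rw [Function.update_of_ne (fun e => hit (by simpa using congrArg Fin.val e)), Function.update_of_ne hit]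
        simp [liftW, hi]
    · have hit : i ≠ t := fun e => hi (e ▸ ht)
      rw [Function.update_of_ne hit]
      simp [liftW, hi]

/-- **A re-indexed program acts as the original on the extension by zeros.** [folklore] -/
theorem liftW_ocEval_map : ∀ (ops : List (RtOp ℕ)) (_ : ∀ op ∈ ops, ∀ i ∈ op.wires, i < N) (w : Fin N → Bool),
    liftW (ocEval A (ops.map (RtOp.map (finOf N hN))) w) = ocEval A ops (liftW w)
  | [], _, w => rfl
  | op :: ops, hops, w => by
    rw [List.map_cons, ocEval_cons, ocEval_cons,
      liftW_ocEval_map ops (fun o ho => hops o (by simp [ho])), liftW_ocAct_map A hN op (hops op (by simp))]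

/-- Pointwise form. [folklore] -/
theorem ocEval_map_finOf_apply (ops : List (RtOp ℕ)) (hops : ∀ op ∈ ops, ∀ i ∈ op.wires, i < N)
    (w : Fin N → Bool) (p : Fin N) :
    ocEval A (ops.map (RtOp.map (finOf N hN))) w p = ocEval A ops (liftW w) p := by
  rw [← liftW_val (ocEval A _ w) p, liftW_ocEval_map A hN ops hops w]

end Transport

/-! ### Compiled programs on basis states -/

section Compile

variable (A : Language Bool) {N : ℕ}

/-- The basis label reached by a placed query is the classical action of the query.
[cite: NielsenChuang2010, §6.1.1 Eq. (6.2)] -/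
theorem oracleTarget_oracleEmb (qs : List (Fin N)) (t : Fin N) (h : (qs ++ [t]).Nodup) (w : QReg N) :
    oracleTarget A (oracleEmb qs t h) w = Function.update w t (w t ^^ A.boolIndicator (qs.map w)) := by
  have hq : queryOf (oracleEmb qs t h) w = qs.map w := by
    unfold queryOf
    apply List.ext_getElem (by simp)
    intro i h1 h2
    rw [List.getElem_ofFn, List.getElem_map, oracleEmb_castSucc qs t h ⟨i, by simpa using h1⟩]
  unfold oracleTarget
  rw [oracleEmb_last, hq]

/-- **Compiled programs of classical operations and queries act classically on basis states**:
`U^A_{compile ops} |w⟩ = |ocEval A ops w⟩`. [cite: BernsteinVazirani1997SICOMP, Thm. 8.3 (proof) and §8.3] -/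
theorem compileList_mulVec_basisState : ∀ (ops : List (RtOp (Fin N))) (_ : ∀ op ∈ ops, IsCl op)
    (h : ∀ op ∈ ops, op.WF) (w : QReg N),
    (⟨RtOp.compileList ops h⟩ : QCircuit cliffordT N).toMatrix A *ᵥ basisState w = basisState (ocEval A ops w)
  | [], _, _, w => by simp [RtOp.compileList]
  | op :: ops, hcl, h, w => by
    rw [RtOp.compileList_cons, toMatrix_mk_append, ← Matrix.mulVec_mulVec, ocEval_cons]
    have hrest := compileList_mulVec_basisState ops (fun o ho => hcl o (List.mem_cons_of_mem _ ho))
      (fun o ho => h o (by simp [ho]))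
    have hcl0 := hcl _ List.mem_cons_self
    have h0 : RtOp.WF op := h _ List.mem_cons_self
    cases op with
    | cl op => rw [RtOp.compile, RevOp.compile_mulVec_basisState, ClOp.eval_toRev, hrest]; rfl
    | had a => exact absurd hcl0 id
    | chad c a => exact absurd hcl0 id
    | oracle qs t =>
      rw [RtOp.compile, show (⟨[QGate.oracle qs.length (oracleEmb qs t h0)]⟩ : QCircuit cliffordT N).toMatrix A =
          placeGate (oracleEmb qs t h0) (oracleGate A qs.length) by
        rw [QCircuit.toMatrix_cons, QCircuit.toMatrix_nil, Matrix.one_mul]; rfl,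
        placeGate_oracleGate_mulVec_basisState, oracleTarget_oracleEmb, hrest]
      rfl

/-- **The `ℕ`-wired form**: for a program with wires below `N`, the compilation of its re-indexing
to `Fin N` maps `|w⟩` to the basis state whose extension by zeros is `ocEval A ops (liftW w)`.
[cite: BernsteinVazirani1997SICOMP, Thm. 8.3 (proof) and §8.3] -/
theorem compileList_map_mulVec_basisState (hN : 0 < N) (ops : List (RtOp ℕ)) (hcl : ∀ op ∈ ops, IsCl op)
    (hlt : ∀ op ∈ ops, ∀ i ∈ op.wires, i < N) (h : ∀ op ∈ ops.map (RtOp.map (finOf N hN)), op.WF) (w : QReg N) :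
    (⟨RtOp.compileList (ops.map (RtOp.map (finOf N hN))) h⟩ : QCircuit cliffordT N).toMatrix A *ᵥ basisState w =
      basisState fun p => ocEval A ops (liftW w) p := by
  have hcl' : ∀ op ∈ ops.map (RtOp.map (finOf N hN)), IsCl op := fun op hop => by
    obtain ⟨op', hop', rfl⟩ := List.mem_map.1 hop
    exact (hcl op' hop').map _
  rw [compileList_mulVec_basisState A _ hcl' h w]
  congr 1; funext p; exact ocEval_map_finOf_apply A hN ops hlt w p

end Compile

/-! ### The garbage-free block placed at an offset -/

section Block

variable {e : ℕ} {M : Turing.TM2ComputableAux Bool Bool}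

/-- The wires of the block (empty suffix) lie below its width. [folklore] -/
theorem cleanOps_nil_lt {n₀ : ℕ} : ∀ op ∈ cleanOps e M n₀ [], ∀ i ∈ wiresOf op, i < width e M n₀ := by
  intro op hop i hi
  have := cleanOps_lt (e := e) (M := M) (n₀ := n₀) (v := []) op hop i hi
  simpa using this

/-- **The block on an arbitrary assignment with clean work wires**: if the first `|d|` wires hold
`d` and the work wires `|d| ≤ i < width` hold `0`, the block leaves the data and every wire beyond
its width unchanged and writes the read-out of the output word onto the work wires.
[cite: Shor1997, §3 p.8 (compute F(x) keeping x, copy, undo)] -/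
theorem clEval_cleanOps_of_agree (d l' : List Bool) (hM : M.OutputsWithin d l' (Tn e d.length))
    (w : ℕ → Bool) (hd : ∀ i < d.length, w i = d.getD i false)
    (hz : ∀ i, d.length ≤ i → i < width e M d.length → w i = false) :
    clEval (cleanOps e M d.length []) w = fun i =>
      if i < width e M d.length then (if i < d.length then d.getD i false else readOut e M d.length l' i) else w i := by
  have hM' : M.OutputsWithin (d ++ []) l' (Tn e (d.length + ([] : List Bool).length)) := by simpa using hM
  have hcan := clEval_cleanOps (e := e) d [] l' hM'
  simp only [List.length_nil, Nat.add_zero] at hcan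
  have hagree : ∀ i, i < width e M d.length → w i = strW d i := by
    intro i hi
    by_cases hid : i < d.length
    · rw [hd i hid]; rfl
    · rw [hz i (not_lt.1 hid) hi, strW, List.getD_eq_default _ _ (not_lt.1 hid)]
  funext i
  by_cases hi : i < width e M d.length
  · rw [if_pos hi, clEval_agree (fun i => i < width e M d.length) _ cleanOps_nil_lt hagree i hi, hcan]
  · rw [if_neg hi]
    exact clEval_apply_of_forall_target_ne _ _ fun op hop heq =>
      hi (heq ▸ cleanOps_nil_lt op hop op.target (by simp))

/-- **The block placed at the offset `S`** (`ClOp.map (· + S)`): if the wires `S, …, S + |d| - 1`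
hold `d` and the wires `S + |d|, …, S + width - 1` hold `0`, then afterwards the block's window holds
data and read-out, and every other wire is unchanged. [cite: Shor1997, §3 p.8] -/
theorem clEval_cleanOps_shift (S : ℕ) (d l' : List Bool) (hM : M.OutputsWithin d l' (Tn e d.length))
    (w : ℕ → Bool) (hd : ∀ i < d.length, w (S + i) = d.getD i false)
    (hz : ∀ i, d.length ≤ i → i < width e M d.length → w (S + i) = false) :
    clEval ((cleanOps e M d.length []).map (ClOp.map (· + S))) w = fun j =>
      if S ≤ j ∧ j < S + width e M d.length then
        (if j - S < d.length then d.getD (j - S) false else readOut e M d.length l' (j - S))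
      else w j := by
  have hinj : Function.Injective (· + S : ℕ → ℕ) := fun a b h => Nat.add_right_cancel h
  have himg := clEval_map_comp hinj (cleanOps e M d.length []) w
  have hloc := clEval_cleanOps_of_agree d l' hM (w ∘ (· + S)) (fun i hi => by simpa [Nat.add_comm] using hd i hi)
    (fun i h1 h2 => by simpa [Nat.add_comm] using hz i h1 h2)
  funext j
  by_cases hj : S ≤ j ∧ j < S + width e M d.length
  · rw [if_pos hj]
    obtain ⟨i, rfl⟩ : ∃ i, j = i + S := ⟨j - S, by omega⟩
    have := congrFun himg i
    simp only [Function.comp_apply] at this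
    rw [this, hloc]
    simp only [Function.comp_apply, Nat.add_sub_cancel]
    rw [if_pos (by omega)]
  · rw [if_neg hj]
    by_cases hjS : S ≤ j
    · obtain ⟨i, rfl⟩ : ∃ i, j = i + S := ⟨j - S, by omega⟩
      have := congrFun himg i
      simp only [Function.comp_apply] at this
      rw [this, hloc]
      simp only [Function.comp_apply]
      rw [if_neg (by omega)]
    · exact clEval_map_apply_of_not_mem_range _ _ w fun ⟨i, hi⟩ => hjS (by simp only at hi; omega)

end Block

end OSim

end Literature.Computability.QuantumComplexity
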